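import Literature.Barriers.AtomisticToContinuum.AnticontinuumLocalization
import Literature.MathematicalPhysics.KineticTheory.TrigPolySeries
import Mathlib.Analysis.Calculus.BumpFunction.InnerProduct
import HarnessLib

/-!
# De Roeck–Huveneers 2015, §3 for the rotor chain: the perturbative scheme and Proposition 1

`Literature/Barriers/AtomisticToContinuum/` — the CONSTRUCTION of §3 of W. De Roeck, F. Huveneers,
CPAM 68 (2015), arXiv:1305.5127, for the finite free rotor chain of the main file
(`RotorChain.hamiltonian m ε γ = D + εV`, `D = ½∑ω²`, `V = ∑_y (γ(1 - cos q_y) + (1 - cos(q_y - q_{y+1})))`),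
with all objects explicit and all of Proposition 1 PROVED:

* the cut-off profile `ρ` (`cutoff`: a smooth bump, `= 1` on `[-1, 1]`, `= 0` outside `(-2, 2)`) and
  the symbolic Hamiltonian `hamSeries m γ = (D, V, 0, …)` (`kinPoly`, `potPoly`), representing the
  truncated series `hamTS m γ n = (D, V, 0, …)` of smooth functions;
* **the recursion (3.6)–(3.10)** `stage m γ n k` (symbolic `𝒯(Q_k H)`): with `P_k = (stage (k-1))_k`
  and the generator `U^{(k)} = L_D⁻¹(Id - 𝓡) P_k` (`gen`), stage `k` is `e^{ε^k ad U^{(k)}}` applied to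
  stage `k - 1` (sharp form `SymSeries.expOpD`, the bracket `{U^{(k)}, D}` being represented through the
  homological equation by `-P_k + 𝓡P_k`), with its order-`k` component REPLACED by the resonant
  polynomial `𝓡 P_k` — literally, so that `H̃ = stage n` has resonant components `H̃^{(k)} = 𝓡 P_k`
  (`stage_apply_self`, eq. (3.10): `H̃^{(k)} = 𝓡(S^{(k-1)}D + Q^{(k-1)}V)`), while semantically nothing
  changes (`stage_represents`: stage `k` represents `Q_k H` with the smooth generators
  `genFun δ k = ev(gen k)`);
* locality: every component of stage `k` is supported within `stageRad n k` of its anchors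
  (`stage_good`, radius `r_k`, eq. (3.11)), for every scale `δ`;
* **Proposition 1 for the rotor chain** (`liouville_eval_rOp`): for every truncated series `f`,
  `L_H (ev_ε(R f)) = ev_ε(R(H̃ f)) + ε^{n+1} {V, (R f)_n}` with `R = R_n` built from the same generators
  and `H̃ = Q_n H` — i.e. parts (1)–(2) of Prop. 1 with the generators CHOSEN as in (3.6).

No named facts; `sorry`-free. The `δ`-bookkeeping ((3.12)–(3.14)) and the mode bookkeeping
(`K_r`) of these objects are recorded in the follow-up files.
-/

noncomputable section

open Function Set Finset Filter Metric
open scoped ContDiff BigOperators Topology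

namespace Literature.Barriers.AtomisticToContinuum.HeatConduction.RotorChain

open Literature.MathematicalPhysics.KineticTheory.HeatConduction
open Literature.Algebra.Lie Literature.Algebra.Lie.TruncSeries

variable {m : ℕ}

/-! ### The cut-off profile `ρ` -/

/-- The bump used as cut-off profile: `rIn = 1`, `rOut = 2`. [cite: DeRoeckHuveneers2015, §3.1 ("`ρ ∈ 𝒞^∞(ℝ, [0,1])`, `ρ(x) = 1` for `x ∈ [-1,1]`, `ρ(x) = 0` for `x ∉ [-2,2]`")] -/
def cutoffBump : ContDiffBump (0 : ℝ) := ⟨1, 2, one_pos, one_lt_two⟩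

/-- The cut-off profile `ρ : ℝ → [0, 1]`, smooth, even, `ρ = 1` on `[-1, 1]`, `ρ = 0` outside `(-2, 2)`.
[cite: DeRoeckHuveneers2015, §3.1] -/
def cutoff (s : ℝ) : ℝ := cutoffBump s

/-- `ρ` is smooth. [cite: DeRoeckHuveneers2015, §3.1] -/
theorem contDiff_cutoff : ContDiff ℝ ∞ cutoff := cutoffBump.contDiff

/-- `ρ = 1` on `[-1, 1]`. [cite: DeRoeckHuveneers2015, §3.1] -/
theorem cutoff_eq_one {s : ℝ} (hs : |s| ≤ 1) : cutoff s = 1 :=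
  cutoffBump.one_of_mem_closedBall (by simpa [cutoffBump, Real.dist_eq] using hs)

/-- `ρ(0) = 1`. [cite: DeRoeckHuveneers2015, §3.1] -/
theorem cutoff_zero : cutoff 0 = 1 := cutoff_eq_one (by simp)

/-- `ρ = 0` outside `(-2, 2)`. [cite: DeRoeckHuveneers2015, §3.1] -/
theorem cutoff_eq_zero {s : ℝ} (hs : 2 ≤ |s|) : cutoff s = 0 :=
  cutoffBump.zero_of_le_dist (by simpa [cutoffBump, Real.dist_eq] using hs)

/-- `ρ = 1` near `0`. [cite: DeRoeckHuveneers2015, §3.1] -/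
theorem cutoff_eventually_one : ∀ᶠ s in 𝓝 (0 : ℝ), cutoff s = 1 :=
  cutoffBump.eventuallyEq_one

/-- `0 ≤ ρ ≤ 1`. [cite: DeRoeckHuveneers2015, §3.1] -/
theorem cutoff_nonneg (s : ℝ) : 0 ≤ cutoff s := cutoffBump.nonneg

/-- `0 ≤ ρ ≤ 1`. [cite: DeRoeckHuveneers2015, §3.1] -/
theorem cutoff_le_one (s : ℝ) : cutoff s ≤ 1 := cutoffBump.le_one

/-- `ρ` is even. [cite: DeRoeckHuveneers2015, §3.1 ("`ρ(-x) = ρ(x)`")] -/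
theorem cutoff_neg (s : ℝ) : cutoff (-s) = cutoff s := cutoffBump.neg s

/-! ### The symbolic Hamiltonian `H = D + εV` -/

/-- The kinetic term `½ω_y²` of site `y` (mode `0`). [cite: DeRoeckHuveneers2015, §2.1 (2.1)] -/
def kinTerm (y : Fin m) : TrigTerm m :=
  { pos := y, mode := 0, cosCoeff := fun _ w => w y ^ 2 / 2, sinCoeff := fun _ _ => 0 }

/-- `D = ∑_y ½ω_y²`, symbolically. [cite: DeRoeckHuveneers2015, §2.1 (2.1)] -/
def kinPoly (m : ℕ) : TrigPoly m := List.ofFn (kinTerm (m := m))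

/-- The potential terms of site `y`: `γ - γ cos q_y` (pinning) and, if the bond `(y, y+1)` exists,
`1 - cos(q_y - q_{y+1})`. [cite: DeRoeckHuveneers2015, §2.1 (2.1)] -/
def potTerms (γ : ℝ) (y : Fin m) : TrigPoly m :=
  [ { pos := y, mode := 0, cosCoeff := fun _ _ => γ, sinCoeff := fun _ _ => 0 },
    { pos := y, mode := Pi.single y 1, cosCoeff := fun _ _ => -γ, sinCoeff := fun _ _ => 0 } ] ++
  (if h : y.val + 1 < m then
    [ { pos := y, mode := 0, cosCoeff := fun _ _ => 1, sinCoeff := fun _ _ => 0 },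
      { pos := y, mode := Pi.single y 1 - Pi.single ⟨y.val + 1, h⟩ 1, cosCoeff := fun _ _ => -1,
        sinCoeff := fun _ _ => 0 } ]
   else [])

/-- `V = ∑_y V_y`, symbolically. [cite: DeRoeckHuveneers2015, §2.1 (2.1)] -/
def potPoly (m : ℕ) (γ : ℝ) : TrigPoly m := (List.finRange m).flatMap (potTerms γ)

/-- The potential energy `∑_y V_y(q)` of the free rotor chain. [cite: DeRoeckHuveneers2015, §2.1 (2.1)] -/
def potentialEnergy (m : ℕ) (γ : ℝ) (z : PhaseSpace m) : ℝ := ∑ y : Fin m, sitePotential m γ z.1 y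

/-- `H = D + εV` as a symbolic truncated series `(D, V, 0, 0, …)`. [cite: DeRoeckHuveneers2015, §3.1 ("`H = D + εV`")] -/
def hamSeries (m : ℕ) (γ : ℝ) : SymSeries m := fun j =>
  if j = 0 then kinPoly m else if j = 1 then potPoly m γ else []

/-- `k·q` for the unit mode `e_y` is `q_y`. [folklore] -/
theorem modePhase_single (y : Fin m) (q : Fin m → ℝ) : modePhase (Pi.single y 1) q = q y := by
  unfold modePhase
  rw [Finset.sum_eq_single y]
  · simp
  · intro x _ hx; simp [hx]
  · intro h; exact absurd (Finset.mem_univ y) h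

/-- `ev D = ½∑ω²`. [cite: DeRoeckHuveneers2015, §2.1 (2.1)] -/
theorem ev_kinPoly (δ : ℝ) (z : PhaseSpace m) : TrigPoly.ev (kinPoly m) δ z = kineticEnergy m z := by
  unfold kinPoly TrigPoly.ev kineticEnergy
  rw [List.map_ofFn, List.sum_ofFn]
  refine Finset.sum_congr rfl fun y _ => ?_
  simp [kinTerm, TrigTerm.ev, modePhase]

/-- `ev V_y = V_y(q)`. [cite: DeRoeckHuveneers2015, §2.1 (2.1)] -/
theorem ev_potTerms (γ δ : ℝ) (y : Fin m) (z : PhaseSpace m) :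
    TrigPoly.ev (potTerms γ y) δ z = sitePotential m γ z.1 y := by
  unfold potTerms sitePotential
  rw [TrigPoly.ev_append]
  have hbond : ∑ y' : Fin m, (if y'.val = y.val + 1 then (1 - Real.cos (z.1 y - z.1 y')) else 0) =
      if h : y.val + 1 < m then 1 - Real.cos (z.1 y - z.1 ⟨y.val + 1, h⟩) else 0 := by
    by_cases h : y.val + 1 < m
    · rw [dif_pos h, Finset.sum_eq_single_of_mem (⟨y.val + 1, h⟩ : Fin m) (Finset.mem_univ _)
        (fun x _ hx => if_neg fun e => hx (Fin.ext e))]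
      simp
    · rw [dif_neg h]
      exact Finset.sum_eq_zero fun x _ => if_neg (by have := x.isLt; omega)
  rw [hbond]
  by_cases h : y.val + 1 < m
  · rw [dif_pos h, dif_pos h]
    simp only [TrigPoly.ev_cons, TrigPoly.ev_nil, TrigTerm.ev, modePhase_sub, modePhase_single]
    simp [modePhase]
    ring
  · rw [dif_neg h, dif_neg h]
    simp only [TrigPoly.ev_cons, TrigPoly.ev_nil, TrigTerm.ev, modePhase_single]
    simp [modePhase]
    ring

/-- `ev V = ∑_y V_y`. [cite: DeRoeckHuveneers2015, §2.1 (2.1)] -/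
theorem ev_potPoly (γ δ : ℝ) (z : PhaseSpace m) : TrigPoly.ev (potPoly m γ) δ z = potentialEnergy m γ z := by
  unfold potPoly potentialEnergy
  rw [TrigPoly.ev_flatMap]
  simp only [ev_potTerms]
  rw [← List.ofFn_eq_map, List.sum_ofFn]

/-- `H = D + εV` for the rotor chain of the main file. [cite: DeRoeckHuveneers2015, §2.1 (2.1)] -/
theorem hamiltonian_eq_kinetic_add (ε γ : ℝ) (z : PhaseSpace m) :
    hamiltonian m ε γ z = kineticEnergy m z + ε * potentialEnergy m γ z := by
  unfold hamiltonian siteEnergy kineticEnergy potentialEnergy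
  rw [Finset.sum_add_distrib, Finset.mul_sum]

/-- `H = D + εV` is good with radius `1` at every scale (local terms, smooth constant coefficients).
[cite: DeRoeckHuveneers2015, §3.1 ("`H_x = D_x(ω) + εV_x(q)`")] -/
theorem hamSeries_good (m n : ℕ) (γ δ : ℝ) : (hamSeries m γ).Good n 1 δ := by
  intro j _
  unfold hamSeries
  by_cases h0 : j = 0
  · rw [if_pos h0]
    refine ⟨fun t ht => ?_, fun t ht => ?_⟩ <;> (rw [kinPoly, List.mem_ofFn] at ht; obtain ⟨y, rfl⟩ := ht)
    · refine ⟨fun x _ => rfl, fun δ' => ⟨?_, dependsOn_const' _ _⟩⟩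
      intro w w' h
      show w y ^ 2 / 2 = w' y ^ 2 / 2
      rw [h y (by show Nat.dist y.val y.val ≤ 1; simp [Nat.dist_self])]
    · exact ⟨by simp only [kinTerm]; fun_prop, contDiff_const⟩
  · rw [if_neg h0]
    by_cases h1 : j = 1
    · rw [if_pos h1]
      refine ⟨fun t ht => ?_, fun t ht => ?_⟩ <;>
        (rw [potPoly, List.mem_flatMap] at ht; obtain ⟨y, -, hty⟩ := ht; unfold potTerms at hty)
      · have hconst : ∀ (c : ℝ) (δ' : ℝ), DependsOn (fun _ : Fin m → ℝ => c) (siteBall y 1) :=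
          fun c _ => dependsOn_const' _ _
        rcases List.mem_append.1 hty with h | h
        · simp only [List.mem_cons, List.mem_nil_iff, or_false] at h
          rcases h with rfl | rfl
          · exact ⟨fun x _ => rfl, fun δ' => ⟨hconst _ δ', hconst _ δ'⟩⟩
          · refine ⟨fun x hx => ?_, fun δ' => ⟨hconst _ δ', hconst _ δ'⟩⟩
            have hxy : x ≠ y := by rintro rfl; simp [Nat.dist_self] at hx
            simp [hxy]
        · by_cases hb : y.val + 1 < m
          · rw [dif_pos hb] at h
            simp only [List.mem_cons, List.mem_nil_iff, or_false] at h
            rcases h with rfl | rfl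
            · exact ⟨fun x _ => rfl, fun δ' => ⟨hconst _ δ', hconst _ δ'⟩⟩
            · refine ⟨fun x hx => ?_, fun δ' => ⟨hconst _ δ', hconst _ δ'⟩⟩
              have hxy : x ≠ y := by rintro rfl; simp [Nat.dist_self] at hx
              have hxy' : x ≠ ⟨y.val + 1, hb⟩ := by
                rintro rfl
                simp only [Nat.dist] at hx
                omega
              simp [hxy, hxy']
          · rw [dif_neg hb] at h; simp at h
      · rcases List.mem_append.1 hty with h | h
        · simp only [List.mem_cons, List.mem_nil_iff, or_false] at h
          rcases h with rfl | rfl <;> exact ⟨contDiff_const, contDiff_const⟩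
        · by_cases hb : y.val + 1 < m
          · rw [dif_pos hb] at h
            simp only [List.mem_cons, List.mem_nil_iff, or_false] at h
            rcases h with rfl | rfl <;> exact ⟨contDiff_const, contDiff_const⟩
          · rw [dif_neg hb] at h; simp at h
    · rw [if_neg h1]
      exact TrigPoly.good_nil _ _

/-! ### The semantic Hamiltonian series `(D, V, 0, …)` -/

/-- `D` as a smooth function. [folklore] -/
def kinFun (m : ℕ) : SmoothFun m := SmoothFun.mk (kineticEnergy m) (contDiff_kineticEnergy m)

/-- `V` is smooth. [folklore] -/
theorem contDiff_potentialEnergy (m : ℕ) (γ : ℝ) : ContDiff ℝ ∞ (potentialEnergy m γ) := by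
  have e : potentialEnergy m γ = TrigPoly.ev (potPoly m γ) 0 := funext fun z => (ev_potPoly γ 0 z).symm
  rw [e]
  exact (hamSeries_good m 1 γ 0 1 le_rfl).contDiff_ev

/-- `V` as a smooth function. [folklore] -/
def potFun (m : ℕ) (γ : ℝ) : SmoothFun m := SmoothFun.mk (potentialEnergy m γ) (contDiff_potentialEnergy m γ)

/-- `H = (D, V, 0, …, 0) ∈ C^∞(Ω_m)[ε]/(ε^{n+1})` (for `n = 0` the truncation drops `V`). [cite: DeRoeckHuveneers2015, §3.1] -/
def hamTS (m : ℕ) (γ : ℝ) (n : ℕ) : TruncSeries (SmoothFun m) n :=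
  TruncSeries.mk (fun j => if j = 0 then kinFun m else if j = 1 ∧ j ≤ n then potFun m γ else 0)
    (fun k hk => by
      have h0 : k ≠ 0 := by omega
      have h1 : ¬ (k = 1 ∧ k ≤ n) := fun h => by omega
      rw [if_neg h0, if_neg h1])

/-- Coefficients of `hamTS`. [folklore] -/
theorem hamTS_coeff (m : ℕ) (γ : ℝ) (n j : ℕ) :
    (hamTS m γ n).coeff j = if j = 0 then kinFun m else if j = 1 ∧ j ≤ n then potFun m γ else 0 := rfl

/-- `H_0 = D`. [folklore] -/
theorem hamTS_coeff_zero (m : ℕ) (γ : ℝ) (n : ℕ) : (hamTS m γ n).coeff 0 = kinFun m := by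
  rw [hamTS_coeff, if_pos rfl]

/-- `H_1 = V` (`n ≥ 1`). [folklore] -/
theorem hamTS_coeff_one (m : ℕ) (γ : ℝ) {n : ℕ} (hn : 1 ≤ n) : (hamTS m γ n).coeff 1 = potFun m γ := by
  rw [hamTS_coeff, if_neg one_ne_zero, if_pos ⟨rfl, hn⟩]

/-- The higher coefficients of `H` vanish. [folklore] -/
theorem hamTS_coeff_eq_zero (m : ℕ) (γ : ℝ) (n : ℕ) {j : ℕ} (hj : 2 ≤ j) : (hamTS m γ n).coeff j = 0 := by
  rw [hamTS_coeff, if_neg (by omega), if_neg (fun h => by omega)]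

/-- `hamSeries` represents `hamTS` at every scale. [folklore] -/
theorem hamSeries_represents (m : ℕ) (γ : ℝ) (n : ℕ) (δ : ℝ) :
    SymSeries.Represents δ n (hamSeries m γ) (hamTS m γ n) := by
  intro j _
  funext z
  rw [hamTS_coeff]
  unfold hamSeries
  by_cases h0 : j = 0
  · simp only [h0, if_true, kinFun, SmoothFun.val_mk, ev_kinPoly]
  · simp only [h0, if_false]
    by_cases h1 : j = 1
    · subst h1
      simp only [true_and, if_true] at *
      rw [if_pos ‹1 ≤ n›]
      simp only [potFun, SmoothFun.val_mk, ev_potPoly]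
    · rw [if_neg (fun h => h1 h.1)]
      simp only [h1, if_false, SmoothFun.val_zero, Pi.zero_apply, TrigPoly.ev_nil]

/-- `ev_ε (D, V, 0, …) = H` for the rotor chain (`n ≥ 1`). [cite: DeRoeckHuveneers2015, §3.1] -/
theorem val_eval_hamTS {n : ℕ} (hn : 1 ≤ n) (ε γ : ℝ) (z : PhaseSpace m) :
    (TruncSeries.eval ε (hamTS m γ n)).val z = hamiltonian m ε γ z := by
  rw [SmoothFun.val_eval, hamiltonian_eq_kinetic_add]
  have h01 : ({0, 1} : Finset ℕ) ⊆ Finset.range (n + 1) := by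
    intro j hj
    simp only [Finset.mem_insert, Finset.mem_singleton] at hj
    rw [Finset.mem_range]; omega
  rw [← Finset.sum_subset h01]
  · rw [Finset.sum_pair zero_ne_one, hamTS_coeff_zero, hamTS_coeff_one m γ hn]
    simp [kinFun, potFun]
  · intro j _ hj
    simp only [Finset.mem_insert, Finset.mem_singleton, not_or] at hj
    rw [hamTS_coeff_eq_zero m γ n (by omega)]
    simp

/-! ### The recursion (3.6)–(3.10) -/

/-- The locality radius after stage `k`: `r_0 = 1`, `r_{k+1} = r_k + 2 n r_k`. [cite: DeRoeckHuveneers2015, §3.2 (3.11)] -/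
def stageRad (n : ℕ) : ℕ → ℕ
  | 0 => 1
  | k + 1 => stageRad n k + 2 * n * stageRad n k

/-- **Stage `k` of the perturbative scheme** (symbolic `𝒯_n(Q_k H)` with resonant components):
stage `0` is `H = (D, V, 0, …)`; for `k + 1 ≤ n`, with `P = (stage k)_{k+1}` and
`U = L_D⁻¹(Id - 𝓡)P` (eq. (3.6)), stage `k + 1` is `e^{ε^{k+1} ad_U}(stage k)` — computed with
`{U, D} := -P + 𝓡P` (the homological equation) — whose component `k + 1` is then replaced by `𝓡P`
(eq. (3.10)); stages beyond `n` are frozen. [cite: DeRoeckHuveneers2015, §3.2 (3.6)–(3.10)] -/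
def stage (m : ℕ) (γ : ℝ) (n : ℕ) : ℕ → SymSeries m
  | 0 => hamSeries m γ
  | k + 1 =>
    if k + 1 ≤ n then
      Function.update
        (SymSeries.expOpD n (k + 1) (stageRad n k) (TrigPoly.solve cutoff (stage m γ n k (k + 1)))
          (TrigPoly.neg (stage m γ n k (k + 1)) ++ TrigPoly.resCut cutoff (stage m γ n k (k + 1)))
          (stageRad n k) (stage m γ n k))
        (k + 1) (TrigPoly.resCut cutoff (stage m γ n k (k + 1)))
    else stage m γ n k

/-- **The generators `U^{(k)} = L_D⁻¹(Id - 𝓡)P_k`**, `P_k = (stage (k-1))_k` (`1 ≤ k ≤ n`; empty otherwise).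
[cite: DeRoeckHuveneers2015, §3.2 eq. (3.6)] -/
def gen (m : ℕ) (γ : ℝ) (n : ℕ) : ℕ → TrigPoly m
  | 0 => []
  | k + 1 => if k + 1 ≤ n then TrigPoly.solve cutoff (stage m γ n k (k + 1)) else []

/-- The symbolic perturbative Hamiltonian `H̃ = H̃_n = 𝒯_n(Q H)`. [cite: DeRoeckHuveneers2015, §3.2 eq. (3.10)] -/
def normalForm (m : ℕ) (γ : ℝ) (n : ℕ) : SymSeries m := stage m γ n n

/-- Unfolding a stage `k + 1 ≤ n`. [cite: DeRoeckHuveneers2015, §3.2 (3.6)–(3.10)] -/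
theorem stage_succ_of_le {n k : ℕ} (γ : ℝ) (hk : k + 1 ≤ n) :
    stage m γ n (k + 1) = Function.update
        (SymSeries.expOpD n (k + 1) (stageRad n k) (TrigPoly.solve cutoff (stage m γ n k (k + 1)))
          (TrigPoly.neg (stage m γ n k (k + 1)) ++ TrigPoly.resCut cutoff (stage m γ n k (k + 1)))
          (stageRad n k) (stage m γ n k))
        (k + 1) (TrigPoly.resCut cutoff (stage m γ n k (k + 1))) := by
  rw [stage, if_pos hk]

/-- Stages beyond `n` are frozen. [folklore] -/
theorem stage_succ_of_lt {n k : ℕ} (γ : ℝ) (hk : n < k + 1) : stage m γ n (k + 1) = stage m γ n k := by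
  rw [stage, if_neg (not_le.2 hk)]

/-- Unfolding a generator `k + 1 ≤ n`. [cite: DeRoeckHuveneers2015, §3.2 (3.6)] -/
theorem gen_succ_of_le {n k : ℕ} (γ : ℝ) (hk : k + 1 ≤ n) :
    gen m γ n (k + 1) = TrigPoly.solve cutoff (stage m γ n k (k + 1)) := by
  rw [gen, if_pos hk]

/-- **Locality of the scheme** (eq. (3.11)): every component of stage `k` is supported within
`stageRad n k` of its anchors and has smooth coefficients, at every scale `δ`. [cite: DeRoeckHuveneers2015, §3.2 (3.11) and §3.3] -/
theorem stage_good (m : ℕ) (γ : ℝ) (n : ℕ) (δ : ℝ) : ∀ k, (stage m γ n k).Good n (stageRad n k) δ := by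
  intro k
  induction k with
  | zero => exact hamSeries_good m n γ δ
  | succ k ih =>
    by_cases hk : k + 1 ≤ n
    · rw [stage_succ_of_le γ hk]
      have hP : (stage m γ n k (k + 1)).Good (stageRad n k) δ := ih (k + 1) hk
      have hU := hP.solve contDiff_cutoff cutoff_eventually_one
      have hUD := (hP.neg).append (hP.resCut contDiff_cutoff)
      have hE := SymSeries.Good.expOpD hU hUD le_rfl (k + 1) ih
      exact hE.update (k + 1) ((hP.resCut contDiff_cutoff).mono (Nat.le_add_right _ _))
    · rw [stage_succ_of_lt γ (not_le.1 hk)]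
      exact ih.mono (Nat.le_add_right _ _)

/-- The generators are good with the radius of the previous stage. [cite: DeRoeckHuveneers2015, §3.2 (3.11)] -/
theorem gen_good (m : ℕ) (γ : ℝ) (n : ℕ) (δ : ℝ) : ∀ k, 1 ≤ k → (gen m γ n k).Good (stageRad n (k - 1)) δ := by
  intro k hk
  obtain ⟨k, rfl⟩ : ∃ k', k = k' + 1 := ⟨k - 1, by omega⟩
  rw [Nat.add_sub_cancel]
  by_cases hkn : k + 1 ≤ n
  · rw [gen_succ_of_le γ hkn]
    exact (stage_good m γ n δ k (k + 1) hkn).solve contDiff_cutoff cutoff_eventually_one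
  · rw [gen, if_neg hkn]
    exact TrigPoly.good_nil _ _

/-- **The generators as smooth functions** `U^{(k)} = ev(gen k)` at scale `δ`. [cite: DeRoeckHuveneers2015, §3.2 eq. (3.6)] -/
def genFun (m : ℕ) (γ : ℝ) (n : ℕ) (δ : ℝ) (k : ℕ) : SmoothFun m :=
  if hk : 1 ≤ k then SmoothFun.mk (TrigPoly.ev (gen m γ n k) δ) (gen_good m γ n δ k hk).contDiff_ev else 0

/-- The function of `genFun`. [folklore] -/
theorem val_genFun (m : ℕ) (γ : ℝ) (n : ℕ) (δ : ℝ) {k : ℕ} (hk : 1 ≤ k) :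
    (genFun m γ n δ k).val = TrigPoly.ev (gen m γ n k) δ := by
  rw [genFun, dif_pos hk, SmoothFun.val_mk]

/-- **The order-`k` component of stage `k` is the resonant polynomial `𝓡P_k`, literally**
(`1 ≤ k ≤ n`), and later stages do not touch it. [cite: DeRoeckHuveneers2015, §3.2 eq. (3.10) ("`H̃^{(k)} = 𝓡(S^{(k-1)}D + Q^{(k-1)}V)`")] -/
theorem stage_apply_self {n k : ℕ} (γ : ℝ) (hk1 : 1 ≤ k) (hkn : k ≤ n) :
    stage m γ n k k = TrigPoly.resCut cutoff (stage m γ n (k - 1) k) := by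
  obtain ⟨k, rfl⟩ : ∃ k', k = k' + 1 := ⟨k - 1, by omega⟩
  rw [stage_succ_of_le γ hkn, Function.update_self, Nat.add_sub_cancel]

/-- Components below the stage index are frozen: `(stage k')_j = (stage k)_j` for `j ≤ k ≤ k'`.
[cite: DeRoeckHuveneers2015, §3.2] -/
theorem stage_apply_stable {n : ℕ} (γ : ℝ) {j k k' : ℕ} (hjk : j ≤ k) (hkk' : k ≤ k') :
    stage m γ n k' j = stage m γ n k j := by
  induction k' with
  | zero => have : k = 0 := by omega
            subst this; rfl
  | succ k' ih =>
    rcases Nat.lt_or_ge k (k' + 1) with h | h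
    · rw [← ih (by omega)]
      by_cases hk : k' + 1 ≤ n
      · rw [stage_succ_of_le γ hk, Function.update_of_ne (by omega), SymSeries.expOpD_apply_of_lt]
        omega
      · rw [stage_succ_of_lt γ (not_le.1 hk)]
    · have : k = k' + 1 := le_antisymm hkk' h
      subst this; rfl

/-- The components of `H̃` of order `1 ≤ k ≤ n` are the resonant polynomials `𝓡P_k`. [cite: DeRoeckHuveneers2015, §3.2 eq. (3.10)] -/
theorem normalForm_apply {n k : ℕ} (γ : ℝ) (hk1 : 1 ≤ k) (hkn : k ≤ n) :
    normalForm m γ n k = TrigPoly.resCut cutoff (stage m γ n (k - 1) k) := by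
  rw [normalForm, stage_apply_stable γ le_rfl hkn, stage_apply_self γ hk1 hkn]

/-- The order-`0` component is `D` throughout. [cite: DeRoeckHuveneers2015, §3.2 ("`H̃^{(0)} = D`")] -/
theorem stage_apply_zero {n : ℕ} (γ : ℝ) (k : ℕ) : stage m γ n k 0 = kinPoly m := by
  rw [stage_apply_stable γ (Nat.zero_le 0) (Nat.zero_le k)]
  rfl

/-- **The bracket of a generator with `D` is represented by `-P + 𝓡P`** (the homological equation):
`{U^{(k)}, D} = -(Id - 𝓡)P_k`. [cite: DeRoeckHuveneers2015, §3.3 ("`L_{U^{(k)}} D = -L_D U^{(k)}`")] -/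
theorem val_lie_genFun_kinFun {n k : ℕ} (γ δ : ℝ) (hkn : k + 1 ≤ n) :
    (⁅genFun m γ n δ (k + 1), kinFun m⁆ : SmoothFun m).val =
      TrigPoly.ev (TrigPoly.neg (stage m γ n k (k + 1)) ++ TrigPoly.resCut cutoff (stage m γ n k (k + 1))) δ := by
  have hP : (stage m γ n k (k + 1)).Good (stageRad n k) δ := stage_good m γ n δ k (k + 1) hkn
  have hU := hP.solve contDiff_cutoff cutoff_eventually_one
  funext z
  rw [SmoothFun.val_lie, val_genFun m γ n δ (Nat.succ_pos k), gen_succ_of_le γ hkn, kinFun, SmoothFun.val_mk,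
    poisson_antisymm, TrigPoly.poisson_kineticEnergy_ev _ z (fun t ht => (hU.2 t ht).differentiable),
    TrigPoly.ev_bracketD_solve cutoff_zero, TrigPoly.ev_append, TrigPoly.ev_neg]
  ring

/-- **Stage `k` represents `Q_k H`** (the semantic truncated series built from the smooth generators
`genFun`), at every scale `δ`: the symbolic replacement of the order-`k` component by `𝓡P_k` changes
nothing semantically, because `Q^{(k)} = S^{(k-1)} + L_{U^{(k)}}` and `L_{U^{(k)}}D = -L_D U^{(k)} = -(Id - 𝓡)P_k`.
[cite: DeRoeckHuveneers2015, §3.3 proof of Prop. 1 (1)] -/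
theorem stage_represents (m : ℕ) (γ : ℝ) (n : ℕ) (δ : ℝ) :
    ∀ k, k ≤ n → SymSeries.Represents δ n (stage m γ n k) (TruncSeries.qOp (genFun m γ n δ) k (hamTS m γ n)) := by
  intro k
  induction k with
  | zero => intro _; exact hamSeries_represents m γ n δ
  | succ k ih =>
    intro hkn
    have ihk := ih (Nat.le_of_succ_le hkn)
    have hP : (stage m γ n k (k + 1)).Good (stageRad n k) δ := stage_good m γ n δ k (k + 1) hkn
    have hU := hP.solve contDiff_cutoff cutoff_eventually_one
    have hUD := (hP.neg).append (hP.resCut contDiff_cutoff)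
    have hu : (genFun m γ n δ (k + 1)).val = TrigPoly.ev (TrigPoly.solve cutoff (stage m γ n k (k + 1))) δ := by
      rw [val_genFun m γ n δ (Nat.succ_pos k), gen_succ_of_le γ hkn]
    -- `(Q_k H)_0 = D`
    have h0 : (TruncSeries.qOp (genFun m γ n δ) k (hamTS m γ n)).coeff 0 = kinFun m := by
      rw [TruncSeries.qOp_coeff_stable (genFun m γ n δ) (Nat.zero_le k) (hamTS m γ n) le_rfl (Nat.zero_le n)]
      rfl
    have huD : (⁅genFun m γ n δ (k + 1), (TruncSeries.qOp (genFun m γ n δ) k (hamTS m γ n)).coeff 0⁆ : SmoothFun m).val =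
        TrigPoly.ev (TrigPoly.neg (stage m γ n k (k + 1)) ++ TrigPoly.resCut cutoff (stage m γ n k (k + 1))) δ := by
      rw [h0]; exact val_lie_genFun_kinFun γ δ hkn
    have hE := SymSeries.Represents.expOpD (Nat.succ_pos k) hU hUD hu huD (stage_good m γ n δ k) ihk
    rw [stage_succ_of_le γ hkn, TruncSeries.qOp_succ]
    refine hE.update (k + 1) fun _ => ?_
    -- the replaced component evaluates as the original one: `𝓡P = P + {U, D}`
    have hj := hE (k + 1) hkn
    rw [← hj]
    funext z
    rw [TruncSeries.expOp_coeff_self (Nat.succ_pos k) _ _ hkn, SmoothFun.val_add, Pi.add_apply, huD,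
      ihk (k + 1) hkn, TrigPoly.ev_append, TrigPoly.ev_neg]
    unfold TrigPoly.resCut
    ring

/-- **`H̃` represents `Q_n H`.** [cite: DeRoeckHuveneers2015, §3.2 eq. (3.10) and Prop. 1 (1)] -/
theorem normalForm_represents (m : ℕ) (γ : ℝ) (n : ℕ) (δ : ℝ) :
    SymSeries.Represents δ n (normalForm m γ n) (TruncSeries.qOp (genFun m γ n δ) n (hamTS m γ n)) :=
  stage_represents m γ n δ n le_rfl

/-! ### Proposition 1 for the rotor chain -/

/-- **Proposition 1 (2) of De Roeck–Huveneers for the rotor chain, with the generators of (3.6):**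
for every truncated series `f` of smooth functions and `R = R_n`, `H̃ = Q_n H` built from the generators
`U^{(1)}, …, U^{(n)}` at scale `δ`,
`L_H (ev_ε(R f))(z) = ev_ε(R (H̃ f))(z) + ε^{n+1} {V, (R f)_n}(z)`
("`L_H(𝒯_{n₁}(R f)) = 𝒯_{n₁}(R L_{H̃} f) + ε^{n₁+1} L_V ∑_k R^{(n₁-k)} f^{(k)}`"). [cite: DeRoeckHuveneers2015, §3.2 Prop. 1 (2)] -/
theorem liouville_eval_rOp {n : ℕ} (hn : 1 ≤ n) (ε γ δ : ℝ) (f : TruncSeries (SmoothFun m) n) (z : PhaseSpace m) :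
    liouville m ε γ (TruncSeries.eval ε (TruncSeries.rOp (genFun m γ n δ) n f)).val z =
      (TruncSeries.eval ε (TruncSeries.rOp (genFun m γ n δ) n
          (TruncSeries.qOp (genFun m γ n δ) n (hamTS m γ n) * f))).val z +
        ε ^ (n + 1) * poisson (potentialEnergy m γ) ((TruncSeries.rOp (genFun m γ n δ) n f).coeff n).val z := by
  have h := DeRoeckHuveneers2015_prop1_part2_apply hn (genFun m γ n δ) n (hamTS m γ n)
    (fun k hk => hamTS_coeff_eq_zero m γ n hk) f ε z
  have eH : (TruncSeries.eval ε (hamTS m γ n)).val = hamiltonian m ε γ := funext fun z => val_eval_hamTS hn ε γ z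
  rw [eH] at h
  rw [hamTS_coeff_one m γ hn] at h
  exact h

/-- **Proposition 1 (1) for the rotor chain:** `R_n(Q_n H) = H`, i.e. `H = 𝒯_n(R H̃)`. [cite: DeRoeckHuveneers2015, §3.2 Prop. 1 (1)] -/
theorem rOp_qOp_hamTS (m : ℕ) (γ : ℝ) (n : ℕ) (δ : ℝ) :
    TruncSeries.rOp (genFun m γ n δ) n (TruncSeries.qOp (genFun m γ n δ) n (hamTS m γ n)) = hamTS m γ n :=
  TruncSeries.rOp_qOp _ n _

end Literature.Barriers.AtomisticToContinuum.HeatConduction.RotorChain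

end
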